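import Summits.AtomisticToContinuum.HydrodynamicLimit.Theses.SuperextensiveClosureCost

/-!
# Birth skeleton for the crux `WeakStrongToInBand` (stmt-AtomisticToContinuum-14428)

Route `SuperextensiveClosureCost` (sub-problem `HydrodynamicLimit`), crux since rev 5 (rank 9):

  `WeakStrongToInBand := MomentumClosureCost → EnergyClosureCost → MaxSpeedBoundPreShock →
     NoDenseInclusions → TransferInequality (inlined) → GibbsInvariance (inlined) →
     BlockEntropyBudget → HydroLimitInBand`,

and `HydroLimitInBand` is VERBATIM the packing-guarded sub-problem Statement. The crux is the
route's ANALYTIC GLUE: the four mechanism cruxes (superexponential closure costs at equilibrium,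
the two a-priori caps along the flow), the static `L²` budget, Liouville invariance and the block
second law must be turned into the law of large numbers of the conserved fields at every `t < T`.

## The line (the route's own two-layer plan, sharpened by the prover's verdict of 2026-08-16)

The route text foresaw `WeakStrongToInBand ⇐ PathwiseEntropyStability (finite-N Dafermos, PDE,
deterministic) → BlockLLNAtZero (static) → glue (union bounds + transfer)`. The first prover on the
item (pitem-14428-0, evidence `analysis-WeakStrongToInBand.md`, verdict refuted-MISSTATED, no
`¬`-theorem) found the typed antecedents cannot carry that plan: (G1) the block-resolution statics
at `t = 0` are not an antecedent; (G2, decisive) nothing typed bounds COHERENT FAST BLOCKS (the block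
kinetic energy per particle) along the flow, so the relative-entropy Gronwall constant is
`≍ (N+1)^{1/24}` under the speed cap alone. This skeleton makes exactly those inputs NAMED STUBS and
separates the deterministic core from the probabilistic bookkeeping:

* `stub_blockLLNAtZero` (S1, static, M): at `t = 0` the ball-averaged block fields at radius
  `ℓ_N = (N+1)^{-1/4}` are `L¹`-close to `(ρ, ρu, E)(0)` in local-Gibbs probability — the ball-kernel
  twin of the PROVED `BoxDissipativeWeakStrong.LocalGibbsFineScale` (stmt-17712, cube kernels).
* `stub_blockCapPreShock` (S2, a-priori, open-problem; the prover's G2 input): pre-shock, along the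
  non-equilibrium flow, every block's kinetic energy is at most `K ×` its mass, in probability — the
  twin of `MaxSpeedBoundPreShock` / `NoDenseInclusions` at block level (cost `≍ N^{1/4}` at
  equilibrium: not transferable, hence a-priori). Stated IN PROBABILITY, never in exponential
  currency (negatives index: `ExpTailBudget` 14607 died of one Gaussian outlier).
* `stub_goodEventLikely` (S3, the probabilistic glue, M/L): from the six contentful antecedents of
  the crux, for EVERY finite family of smooth tests/windows and every `δ > 0`, the GOOD EVENT
  (genuine trajectory, both caps on `[0,t]`, all listed closure defects `≤ δ`, block-entropy gain
  `≤ δ` at the listed times and at `t`, and the Lebesgue measure of the bad intermediate times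
  `≤ δ`) has local-Gibbs probability `→ 1`: Cauchy–Schwarz transfer of the superexponential bounds
  (landed: `Theorems.localGibbsLaw_tendsto_zero_of_transfer`), the caps (landed:
  `Theorems.superextensiveClosureCost_caps_negligible`), finite unions, and Fubini + dominated
  convergence in the window endpoint for the a.e.-in-time part (joint measurability of the flow on
  the good set is landed: `HardSphereFlow.measurable_flow_prod_torus`).
* `stub_pathwiseDafermos` (S4, THE LEVER, deterministic, XL): finite-`N` Dafermos relative-entropy
  stability of the classical solution WITHIN THE CLASS OF BLOCK FIELDS OF GOOD TRAJECTORIES: for a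
  classical hard-sphere-Euler solution in the packing band and every `ε > 0` there are a finite test
  family (the components of `Dη_σ(Ū)` on windows based at `0`, a time grid), a threshold `δ > 0` and
  `N₀` such that for `N ≥ N₀` every configuration in the good event whose blocks obey the block cap
  and whose initial block deviation is `≤ δ` has block deviation `≤ ε` at time `t`. Inputs it may
  use by name: `HsEosLowDensity_holds`, `HsEntropyConvex` (9906, proved), the exact pathwise mass
  balance of ball averages, conservation of totals (landed ball-kernel integrals in
  `Theorems/SuperextensiveClosureCostBlockEntropyBudgetBallAverages.lean`).
* `stub_blocksToFields` (S5, smearing, M): block deviation `→ 0` in probability at time `t` implies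
  `TendstoHydroFieldsAt … t` (uniform continuity of the continuous test `χ` at scale `ℓ_N`, total
  kinetic energy bounded on the good part, Cauchy–Schwarz/`L∞` pairing).

`WeakStrongToInBand_of` (sorry-free): `η₀ := min η̄₃ η̄₄ / 2`, `σ₀ := min σ₁ σ₂ σ₃`; at `(σ, solution,
Φ, t, ε)` take S4's `(F, δ, N₀)`; the event `{ε < blockDev(t)}` is contained, for `N ≥ N₀`, in
`GoodEventᶜ ∪ {block cap fails} ∪ {δ < blockDev(0)}` (contrapositive of S4), whose three
probabilities tend to `0` by S3, S2, S1; S5 turns block convergence into the conjunct's conclusion.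
The inlined `GibbsInvariance` antecedent is not consumed by the glue (it serves the provers of the
closure-cost cruxes) and is discarded.

Disproof used: none relevant (no `Disproof.lean`, no `Negative/` lemma, no dead line is registered
for this crux at birth; `ledger crux ls stmt-AtomisticToContinuum-14428`: no workfiles).
-/

noncomputable section

namespace Summit.AtomisticToContinuum.HydrodynamicLimit.Cruxes.WeakStrongToInBand.Birth

open scoped BigOperators Topology ENNReal
open Filter Set MeasureTheory
open Literature.MathematicalPhysics.KineticTheory Literature.Analysis.FluidPDE
open Summit.AtomisticToContinuum.HydrodynamicLimit.Theses.SuperextensiveClosureCost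

/-! ## Types (the crux's) -/

/-- Phase space of `N + 1` spheres on `𝕋³`. -/
abbrev Cfg (N : ℕ) : Type := Config (N + 1) (Fin 3) T3

/-- A hard-sphere flow of `N + 1` spheres of diameter `hsDiameter σ N = σ (N+1)^{-1/3}` on `𝕋³`. -/
abbrev Flow (σ : ℝ) (N : ℕ) : Type :=
  HardSphereFlow (Torus.geometry (Fin 3)) (hsDiameter σ N) (N + 1)

/-- Families of flows (the conjunct's `Φ`). -/
abbrev Flows (σ : ℝ) : Type := (N : ℕ) → Flow σ N

/-! ## Block fields — VERBATIM the ball kernel of `MomentumClosureCost` / `EnergyClosureCost` /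
`NoDenseInclusions` / `BlockEntropyBudget` (radius `ℓ_N = (N+1)^{-1/4}`, `≍ N^{1/4}` spheres per ball) -/

/-- The block scale `ℓ_N = (N+1)^{-1/4}`. -/
def ell (N : ℕ) : ℝ := ((N + 1 : ℕ) : ℝ) ^ (-(1 / 4 : ℝ))

/-- The normalised ball kernel `χ_N(x, ·) = 𝟙{d(x,·) < ℓ_N} / ((4/3)πℓ_N³)` (the `χ` of the cruxes). -/
def ballK (N : ℕ) (x : T3) : T3 → ℝ :=
  fun y => if Torus.euclidDist x y < ell N then (4 / 3 * Real.pi * ell N ^ 3)⁻¹ else 0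

/-- Ball-averaged empirical density `ρ^ℓ(x)` of a configuration. -/
def bρ {N : ℕ} (w : Cfg N) (x : T3) : ℝ := empiricalDensityField w (ballK N x)

/-- Ball-averaged empirical momentum `m^ℓ(x)`. -/
def bm {N : ℕ} (w : Cfg N) (x : T3) : V3 := empiricalMomentumField w (ballK N x)

/-- Ball-averaged empirical kinetic energy `E^ℓ(x)`. -/
def be {N : ℕ} (w : Cfg N) (x : T3) : ℝ := empiricalEnergyField w (ballK N x)

/-- Block temperature `θ^ℓ = (2/3)(E^ℓ/ρ^ℓ − |m^ℓ|²/(2(ρ^ℓ)²))` (the cruxes' expression, junk `0/0`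
conventions included). -/
def bθ {N : ℕ} (w : Cfg N) (x : T3) : ℝ :=
  2 / 3 * (be w x / bρ w x - ‖bm w x‖ ^ 2 / (2 * bρ w x ^ 2))

/-- Block pressure `p^ℓ = hsPressure σ ρ^ℓ θ^ℓ` (the flux closure of the cruxes). -/
def bp (σ : ℝ) {N : ℕ} (w : Cfg N) (x : T3) : ℝ := hsPressure σ (bρ w x) (bθ w x)

/-- Block mathematical entropy `η_σ(U^ℓ) = −ρ^ℓ(3/2 log θ^ℓ − log ρ^ℓ − f_ex(ρ^ℓσ³))` — verbatim the
`ηB` of `BlockEntropyBudget`. -/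
def bη (σ : ℝ) {N : ℕ} (w : Cfg N) (x : T3) : ℝ :=
  -(bρ w x * (3 / 2 * Real.log (bθ w x) - Real.log (bρ w x) - hsExcessFreeEnergy (bρ w x * σ ^ 3)))

/-- Total block entropy `∫ η_σ(U^ℓ(x)) dx`. -/
def totalEntropy (σ : ℝ) {N : ℕ} (w : Cfg N) : ℝ := ∫ x, bη σ w x

/-! ## Trajectory functionals: closure defects (VERBATIM the `D_N` of the closure-cost cruxes),
caps, block deviation from the classical solution -/

/-- Raw empirical momentum tested with a vector field: `(N+1)⁻¹ ∑ᵢ g(xᵢ(r))·vᵢ(r)` (the `Mt` of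
`MomentumClosureCost`). -/
def rawMom {σ : ℝ} {N : ℕ} (Ψ : Flow σ N) (z : Cfg N) (r : ℝ) (g : T3 → V3) : ℝ :=
  ∑ j, (empiricalMomentumField (Ψ.flow r z) (fun y => g y j)) j

/-- Raw empirical kinetic energy tested with a scalar field (the `Et` of `EnergyClosureCost`). -/
def rawEn {σ : ℝ} {N : ℕ} (Ψ : Flow σ N) (z : Cfg N) (r : ℝ) (g : T3 → ℝ) : ℝ :=
  empiricalEnergyField (Ψ.flow r z) g

/-- Time-integrated weak-form MOMENTUM closure defect on the window `[s, s+τ]` against the test `ψ`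
(fluxes `ρu⊗u + p𝟙` on ball-averaged fields) — the quantity `MomentumClosureCost` prices. -/
def momDefect {σ : ℝ} {N : ℕ} (Ψ : Flow σ N) (s τ : ℝ) (ψ : ℝ → T3 → V3) (z : Cfg N) : ℝ :=
  rawMom Ψ z (s + τ) (ψ (s + τ)) - rawMom Ψ z s (ψ s) -
    ∫ r in s..(s + τ),
      (rawMom Ψ z r (Literature.Analysis.FunctionSpaces.Torus.timeDerivWithin (Set.Icc s (s + τ)) ψ r) +
        ∫ x, ((∑ i, ∑ j, (Literature.Analysis.FunctionSpaces.Torus.partialDeriv i (ψ r) x) j *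
            (bm (Ψ.flow r z) x i * bm (Ψ.flow r z) x j / bρ (Ψ.flow r z) x)) +
          bp σ (Ψ.flow r z) x * Literature.Analysis.FunctionSpaces.Torus.divergence (ψ r) x))

/-- Time-integrated weak-form ENERGY closure defect on `[s, s+τ]` against `φ` (flux `(E + p)u` on
ball-averaged fields) — the quantity `EnergyClosureCost` prices. -/
def enDefect {σ : ℝ} {N : ℕ} (Ψ : Flow σ N) (s τ : ℝ) (φ : ℝ → T3 → ℝ) (z : Cfg N) : ℝ :=
  rawEn Ψ z (s + τ) (φ (s + τ)) - rawEn Ψ z s (φ s) -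
    ∫ r in s..(s + τ),
      (rawEn Ψ z r (Literature.Analysis.FunctionSpaces.Torus.timeDerivWithin (Set.Icc s (s + τ)) φ r) +
        ∫ x, (be (Ψ.flow r z) x + bp σ (Ψ.flow r z) x) *
          (∑ i, (bm (Ψ.flow r z) x i / bρ (Ψ.flow r z) x) *
            (Literature.Analysis.FunctionSpaces.Torus.gradient (φ r) x) i))

/-- The two CAPS on `[0, t]`: every speed `≤ (N+1)^{1/24}` and every ball packing `ρ^ℓσ³ ≤ η₁`
(the complement of the negligible union of `MaxSpeedBoundPreShock` / `NoDenseInclusions`). -/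
def CapsHold (η₁ t : ℝ) {σ : ℝ} {N : ℕ} (Ψ : Flow σ N) (z : Cfg N) : Prop :=
  (∀ r ∈ Set.Icc 0 t, ∀ i, ‖(Ψ.flow r z i).2‖ ≤ ((N + 1 : ℕ) : ℝ) ^ (1 / 24 : ℝ)) ∧
    ∀ r ∈ Set.Icc 0 t, ∀ x, bρ (Ψ.flow r z) x * σ ^ 3 ≤ η₁

/-- The BLOCK CAP on `[0, t]` (new, the prover's G2 input): every ball's kinetic energy is at most
`K` times its mass, `E^ℓ ≤ K ρ^ℓ` — bounded block velocity AND block temperature (empty balls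
comply). This is what makes the relative-entropy Gronwall constant `N`-uniform. -/
def BlockCapsHold (K t : ℝ) {σ : ℝ} {N : ℕ} (Ψ : Flow σ N) (z : Cfg N) : Prop :=
  ∀ r ∈ Set.Icc 0 t, ∀ x, be (Ψ.flow r z) x ≤ K * bρ (Ψ.flow r z) x

/-- `L¹` BLOCK DEVIATION at time `r` of the ball-averaged fields from the classical solution
`(ρ, ρu, E)(r)` (the quantity of `LocalGibbsFineScale`, with the ball kernel). -/
def blockDev (ρ θ : ℝ → T3 → ℝ) (u : ℝ → T3 → V3) {σ : ℝ} {N : ℕ} (Ψ : Flow σ N) (r : ℝ)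
    (z : Cfg N) : ℝ :=
  ∫ x, (|bρ (Ψ.flow r z) x - ρ r x| + ‖bm (Ψ.flow r z) x - ρ r x • u r x‖ +
    |be (Ψ.flow r z) x - totalEnergyDensity (ρ r x) (u r x) (θ r x)|)

/-- Block-entropy GAIN between the datum `z` and time `r` (the event variable of
`BlockEntropyBudget`, which compares `∫ηB z` with `∫ηB (Φ.flow r z)`). -/
def entropyGain {σ : ℝ} {N : ℕ} (Ψ : Flow σ N) (r : ℝ) (z : Cfg N) : ℝ :=
  totalEntropy σ (Ψ.flow r z) - totalEntropy σ z

/-! ## Finite test families and the good event (the interface between the probabilistic glue S3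
and the deterministic core S4) -/

/-- A FINITE family of closure tests inside `[0, t]`: `kM` momentum tests `(sᵢ, τᵢ, ψᵢ)` and `kE`
energy tests `(sⱼ, τⱼ, φⱼ)` — windows `[s, s+τ] ⊆ [0, t]`, `τ > 0`, tests smooth on their window,
exactly the data `MomentumClosureCost` / `EnergyClosureCost` quantify over — and `kS` entropy grid
times in `[0, t]`. Chosen by the deterministic core (S4), served by the glue (S3). -/
structure TestFamily (t : ℝ) where
  /-- number of momentum tests -/
  kM : ℕ
  /-- window starts of the momentum tests -/
  sM : Fin kM → ℝ
  /-- window lengths of the momentum tests -/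
  τM : Fin kM → ℝ
  /-- the momentum tests -/
  ψ : Fin kM → ℝ → T3 → V3
  /-- number of energy tests -/
  kE : ℕ
  /-- window starts of the energy tests -/
  sE : Fin kE → ℝ
  /-- window lengths of the energy tests -/
  τE : Fin kE → ℝ
  /-- the energy tests -/
  φ : Fin kE → ℝ → T3 → ℝ
  /-- number of entropy grid times -/
  kS : ℕ
  /-- the entropy grid times -/
  rS : Fin kS → ℝ
  hM : ∀ i, 0 ≤ sM i ∧ 0 < τM i ∧ sM i + τM i ≤ t ∧
    Literature.Analysis.FunctionSpaces.Torus.IsSmoothSpaceTimeOn (Set.Icc (sM i) (sM i + τM i)) (ψ i)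
  hE : ∀ j, 0 ≤ sE j ∧ 0 < τE j ∧ sE j + τE j ≤ t ∧
    Literature.Analysis.FunctionSpaces.Torus.IsSmoothSpaceTimeOn (Set.Icc (sE j) (sE j + τE j)) (φ j)
  hS : ∀ k, rS k ∈ Set.Icc 0 t

/-- The BAD INTERMEDIATE TIMES of a trajectory for the family `F` at threshold `δ`: times
`r ∈ [0, t]` at which the block-entropy gain exceeds `δ`, or some listed test, re-windowed to
`[sᵢ, r]`, has closure defect `> δ`. (Pointwise in `r` each is negligible by the cruxes; only its
Lebesgue measure is asked to be small — Fubini, no time-uniformity.) -/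
def badTimes (t : ℝ) (F : TestFamily t) (δ : ℝ) {σ : ℝ} {N : ℕ} (Ψ : Flow σ N) (z : Cfg N) :
    Set ℝ :=
  {r | r ∈ Set.Icc 0 t ∧
    (δ < entropyGain Ψ r z ∨
      (∃ i, F.sM i < r ∧ r ≤ F.sM i + F.τM i ∧ δ < |momDefect Ψ (F.sM i) (r - F.sM i) (F.ψ i) z|) ∨
      (∃ j, F.sE j < r ∧ r ≤ F.sE j + F.τE j ∧ δ < |enDefect Ψ (F.sE j) (r - F.sE j) (F.φ j) z|))}

/-- The GOOD EVENT at `(σ, η₁, t, F, δ)`: a genuine trajectory (`z ∈ Ψ.good`), both caps on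
`[0, t]` with packing threshold `η₁`, every listed closure defect `≤ δ` on its full window,
block-entropy gain `≤ δ` at every grid time and at `t`, and bad intermediate times of Lebesgue
measure `≤ δ`. -/
def GoodEvent (σ η₁ t : ℝ) (F : TestFamily t) (δ : ℝ) {N : ℕ} (Ψ : Flow σ N) : Set (Cfg N) :=
  {z | z ∈ Ψ.good ∧ CapsHold η₁ t Ψ z ∧
    (∀ i, |momDefect Ψ (F.sM i) (F.τM i) (F.ψ i) z| ≤ δ) ∧
    (∀ j, |enDefect Ψ (F.sE j) (F.τE j) (F.φ j) z| ≤ δ) ∧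
    (∀ k, entropyGain Ψ (F.rS k) z ≤ δ) ∧ entropyGain Ψ t z ≤ δ ∧
    volume (badTimes t F δ Ψ z) ≤ ENNReal.ofReal δ}

/-! ## The five registered stubs -/

/-- **S1 — BLOCK LAW OF LARGE NUMBERS AT `t = 0`** (static; size M). For continuous positive
profiles there is `σ₀ > 0` such that for `0 < σ < σ₀`, every classical solution on a non-empty
`[0,T)` whose `t = 0` fields are the macroscopic LLN limit of the local Gibbs laws, and every
`δ > 0`: the local-Gibbs probability that the `L¹` block deviation at time `0` (ball kernel, radius
`(N+1)^{-1/4}`, `≍ N^{1/4}` spheres per ball) exceeds `δ` tends to `0`.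
Why plausibly true: it is `BoxDissipativeWeakStrong.LocalGibbsFineScale` (stmt-17712, PROVED:
`Theorems.LGFS.localGibbsFineScale_of_pos`, cube kernels, in `L¹(P)`) for the ball kernel, weakened
to convergence in probability (Markov); low-activity cluster expansion at block resolution
(correlation length `≍ (N+1)^{-1/3} ≪ ℓ_N`) plus Gaussian velocities; the macroscopic hypothesis
identifies the limit profiles. Leans on: `localGibbs_lln_holds`, `integral_ballKernel_eq_one`,
`blockScale_lt_half`. Sources: Ruelle1969 §3.4, LebowitzPenrose1964, Spohn1991 Part I §3.1. -/
theorem stub_blockLLNAtZero :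
    ∀ (a₀ θ₀ : T3 → ℝ) (u₀ : T3 → V3), Continuous a₀ → Continuous θ₀ → Continuous u₀ →
      (∀ x, 0 < a₀ x) → (∀ x, 0 < θ₀ x) →
      ∃ σ₀ : ℝ, 0 < σ₀ ∧ ∀ σ : ℝ, 0 < σ → σ < σ₀ →
        ∀ (T : ℝ) (ρ θ : ℝ → T3 → ℝ) (u : ℝ → T3 → V3), IsHardSphereEulerSolution σ T ρ u θ →
          0 < T → ∀ Φ : Flows σ,
            TendstoHydroFieldsAt (fun N => localGibbsLaw σ a₀ u₀ θ₀ N (Φ N)) Φ ρ u θ 0 →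
              ∀ δ : ℝ, 0 < δ →
                Tendsto (fun N : ℕ => localGibbsLaw σ a₀ u₀ θ₀ N (Φ N)
                  {z | δ < blockDev ρ θ u (Φ N) 0 z}) atTop (𝓝 0) := by
  sorry

/-- **S2 — BLOCK ENERGY CAP PRE-SHOCK** (a-priori, along the NON-equilibrium deterministic flow;
open-problem; the first prover's decisive missing input G2, "FourthMomentCapPreShock" in block
form). For continuous positive profiles there are `K` and `σ₀ > 0` such that for `0 < σ < σ₀`, every
classical solution on `[0,T)`, every flow family with the `t = 0` LLN and every `t < T`: the
local-Gibbs probability that at some `r ∈ [0,t]` some ball of radius `(N+1)^{-1/4}` has kinetic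
energy `> K ×` its mass tends to `0`.
Why plausibly true: at `t = 0` (and under the invariant law at all times) a ball holds `≍ N^{1/4}`
nearly independent Maxwellian energies, so a block mean `> K` costs `exp(−cN^{1/4})`, beating the
`N^{3/4}`-net of balls and a polynomial time net; one outlier sphere needs `|v|² ≳ N^{1/4}`. Along
the flow it is, like `MaxSpeedBoundPreShock` (twin statement, same prefix), want of technique: cost
`N^{1/4} ≪ N` is not transferable by the `L²` budget, no maximum principle for collision cascades.
Why it might fail: a pre-shock mesoscopic focusing concentrating kinetic energy `≍ N^{-3/4}` into one
ball with probability `↛ 0`. Stated in probability (the exponential-currency cousin `ExpTailBudget`,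
stmt-14607, is refuted by one Gaussian outlier at `t = 0`). Sources: Spohn1991 Part I Ch. 3,
OllaVaradhanYau1993 §1, NachtergaeleYau2003, BodineauGallagherSaintRaymondInvent2016. -/
theorem stub_blockCapPreShock :
    ∀ (a₀ θ₀ : T3 → ℝ) (u₀ : T3 → V3), Continuous a₀ → Continuous θ₀ → Continuous u₀ →
      (∀ x, 0 < a₀ x) → (∀ x, 0 < θ₀ x) →
      ∃ K σ₀ : ℝ, 0 < σ₀ ∧ ∀ σ : ℝ, 0 < σ → σ < σ₀ →
        ∀ (T : ℝ) (ρ θ : ℝ → T3 → ℝ) (u : ℝ → T3 → V3), IsHardSphereEulerSolution σ T ρ u θ →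
          ∀ Φ : Flows σ,
            TendstoHydroFieldsAt (fun N => localGibbsLaw σ a₀ u₀ θ₀ N (Φ N)) Φ ρ u θ 0 →
              ∀ t ∈ Set.Ico 0 T,
                Tendsto (fun N : ℕ => localGibbsLaw σ a₀ u₀ θ₀ N (Φ N)
                  {z | ¬ BlockCapsHold K t (Φ N) z}) atTop (𝓝 0) := by
  sorry

/-- **S3 — THE GOOD EVENT IS LIKELY** (probabilistic glue; size M/L). From the crux's contentful
antecedents — `MomentumClosureCost`, `EnergyClosureCost` (superexponential closure costs under the
invariant homogeneous law, inside both caps), `MaxSpeedBoundPreShock`, `NoDenseInclusions` (the caps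
along the flow), `TransferInequality` (the static `L²` budget `LG(S)² ≤ e^{C(N+1)} G(S)`, named form
of the inlined antecedent, definitionally equal) and `BlockEntropyBudget` — there is `η̄ > 0` such
that for every packing threshold `0 < η₁ ≤ η̄`, continuous positive profiles, `σ < σ₀`, every
classical solution in the band `ρσ³ < η₁/2`, every flow family with the `t = 0` LLN, every `t < T`,
EVERY finite test family `F` in `[0,t]` and every `δ > 0`, the complement of the good event has
local-Gibbs probability `→ 0`.
Proof plan: `η̄ := min η₁ᴹ η₁ᴱ` (the thresholds of the two closure cruxes; smaller `η₁` shrink the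
capped defect events and `NoDenseInclusions` is `∀ η₁`), `θe := 1 + sup θ₀` (compact torus),
`σ₀ := min` of the five thresholds and `1/2`; `LG(goodᶜ) = 0` (`particleLaw ≪ liouville`); caps:
`Theorems.superextensiveClosureCost_caps_negligible`; each full-window defect: the crux's event at
`(sᵢ, τᵢ, ψᵢ, δ)` contains `{caps} ∩ {δ < |defect|}`, transfer by
`Theorems.localGibbsLaw_tendsto_zero_of_transfer`; entropy at grid times and at `t`:
`BlockEntropyBudget` verbatim (`lt_sub_iff_add_lt`); the a.e.-time clause: Markov on
`E[volume(badTimes)] = ∫₀ᵗ LG(bad at r) dr` (Tonelli on `good × [0,t]`,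
`HardSphereFlow.measurable_flow_prod_torus`), the integrand `→ 0` pointwise in `r` by the same three
inputs re-windowed to `[sᵢ, r]` (`IsSmoothSpaceTimeOn` is monotone in the time set), dominated by `1`
(`isProbabilityMeasure_localGibbsLaw`, `σ ≤ 1/2`); finite unions
(`Theorems.measure_biUnion_finset_tendsto_zero`). Why it might fail: only through measurability
bookkeeping of the defect functionals in `(r, z)` — no mathematical obstruction. Sources:
KipnisLandim1999 Ch. 10 §5, Spohn1991 Part I Ch. 3. -/
theorem stub_goodEventLikely :
    MomentumClosureCost → EnergyClosureCost → MaxSpeedBoundPreShock → NoDenseInclusions →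
      TransferInequality → BlockEntropyBudget →
      ∃ ηbar : ℝ, 0 < ηbar ∧ ∀ η₁ : ℝ, 0 < η₁ → η₁ ≤ ηbar →
        ∀ (a₀ θ₀ : T3 → ℝ) (u₀ : T3 → V3), Continuous a₀ → Continuous θ₀ → Continuous u₀ →
          (∀ x, 0 < a₀ x) → (∀ x, 0 < θ₀ x) →
          ∃ σ₀ : ℝ, 0 < σ₀ ∧ ∀ σ : ℝ, 0 < σ → σ < σ₀ →
            ∀ (T : ℝ) (ρ θ : ℝ → T3 → ℝ) (u : ℝ → T3 → V3), IsHardSphereEulerSolution σ T ρ u θ →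
              (∀ r ∈ Set.Ico 0 T, ∀ x, ρ r x * σ ^ 3 < η₁ / 2) →
              ∀ Φ : Flows σ,
                TendstoHydroFieldsAt (fun N => localGibbsLaw σ a₀ u₀ θ₀ N (Φ N)) Φ ρ u θ 0 →
                  ∀ t ∈ Set.Ico 0 T, ∀ (F : TestFamily t) (δ : ℝ), 0 < δ →
                    Tendsto (fun N : ℕ => localGibbsLaw σ a₀ u₀ θ₀ N (Φ N)
                      (GoodEvent σ η₁ t F δ (Φ N))ᶜ) atTop (𝓝 0) := by
  sorry

/-- **S4 — PATHWISE FINITE-`N` DAFERMOS STABILITY** (THE LEVER; deterministic, no measure; size XL).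
There is an EOS band `η̄ > 0` such that for every `0 < η₁ ≤ η̄`, every block-cap constant `K`, every
`σ > 0`, every classical hard-sphere-Euler solution `Ū = (ρ, ρu, E)` on `[0,T)` in the band
`ρσ³ < η₁/2`, every `t < T` and `ε > 0` THERE EXIST a finite test family `F` in `[0,t]`, a threshold
`δ > 0` and `N₀` such that for all `N ≥ N₀`, every hard-sphere flow of `N+1` spheres and every
configuration `z` in the good event whose blocks obey the cap `E^ℓ ≤ Kρ^ℓ` on `[0,t]` and whose
initial block deviation is `≤ δ`, the block deviation at time `t` is `≤ ε`.
Proof plan (Dafermos1979 / DiPerna relative entropy, run on ONE trajectory): `F :=` the momentum test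
`ψ = ∂_m η_σ(Ū)` and the energy test `φ = ∂_E η_σ(Ū)` on the window `[0,t]` (smooth: `Ū` classical,
`θ̄ > 0`), plus a grid; `H(r) = ∫ η_σ(U^ℓ) − η_σ(Ū) − Dη_σ(Ū)(U^ℓ − Ū)`; `∫η_σ(U^ℓ(r))` is controlled by
the entropy-gain clauses (at `t`, and at a.e. `r` via `badTimes`), the linear part by the EXACT
pathwise mass balance of ball averages plus the two closure defects (`≤ δ` on `[0,r]` for a.e. `r`
and for `r = t`; raw-vs-block pairing error `O(ℓ_N ‖∇ψ‖ × kinetic energy)`), the relative flux by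
`C(K, η₁, σ, Ū) ∫|U^ℓ − Ū|²` because the block cap and the packing cap confine `U^ℓ` to a compact
state region on which `η_σ` is uniformly convex (`HsEntropyConvex`, 9906, proved, from
`HsEosLowDensity_holds`) and the fluxes are `C²`; Gronwall in integral form with the bad-time set of
measure `≤ δ` as a forcing term; `L¹ ≤ L²^{1/2}` at the end, `L¹ ⇒` relative entropy small at
`r = 0` by uniform continuity of `η_σ` on the cap region. Why it might fail: the cap region touches
vacuum / cold blocks (`ρ^ℓ → 0`, `θ^ℓ → 0`) where `η_σ` is continuous but not uniformly convex — the
quadratic lower bound `η(U|Ū) ≥ c|U − Ū|²` must be proved on the whole capped region with `Ū` in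
its interior (true for the ideal-gas part; the excess part is analytic in the band). Leans on:
`HsEosLowDensity_holds`, `HsEntropyConvex`, `HardSphereFlow.isTrajectory`, landed ball-kernel
integrals. Sources: Dafermos1979, BrezinaFeireisl2018 Thm 3.3, GwiazdaSwierczewskagwiazdaWiedemann2015,
FeireislNovotny2012. -/
theorem stub_pathwiseDafermos :
    ∃ ηbar : ℝ, 0 < ηbar ∧ ∀ η₁ : ℝ, 0 < η₁ → η₁ ≤ ηbar → ∀ (K σ : ℝ), 0 < σ →
      ∀ (T : ℝ) (ρ θ : ℝ → T3 → ℝ) (u : ℝ → T3 → V3), IsHardSphereEulerSolution σ T ρ u θ →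
        (∀ r ∈ Set.Ico 0 T, ∀ x, ρ r x * σ ^ 3 < η₁ / 2) →
        ∀ t ∈ Set.Ico 0 T, ∀ ε : ℝ, 0 < ε →
          ∃ (F : TestFamily t) (δ : ℝ), 0 < δ ∧ ∃ N₀ : ℕ, ∀ N : ℕ, N₀ ≤ N →
            ∀ (Ψ : Flow σ N) (z : Cfg N), z ∈ GoodEvent σ η₁ t F δ Ψ →
              BlockCapsHold K t Ψ z → blockDev ρ θ u Ψ 0 z ≤ δ → blockDev ρ θ u Ψ t z ≤ ε := by
  sorry

/-- **S5 — FROM BLOCKS TO TESTED FIELDS** (smearing; size M). If at time `t < T` the `L¹` block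
deviation from a classical solution tends to `0` in probability under some laws `localGibbsLaw σ a₀
u₀ θ₀ N (Φ N)`, then the empirical density / momentum / energy fields tested against every continuous
`χ` converge in probability to `∫χρ(t)`, `∫χρu(t)`, `∫χE(t)` — i.e. `TendstoHydroFieldsAt … t`.
Proof plan: `|⟨χ, μ_N⟩ − ∫χρ^ℓ| ≤ ω_χ(ℓ_N)` (uniform continuity of `χ` on the compact torus,
`∫χ_N(x,·)dx = 1` for `ℓ_N < 1/2`: `integral_ballKernel_eq_one`, `blockScale_lt_half`; for momentum /
energy times the total kinetic energy, which is `≤ ∫E(t) + 1` on `{blockDev ≤ 1}`), and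
`|∫χ(ρ^ℓ − ρ(t))| ≤ ‖χ‖_∞ · blockDev`; `(ρ,u,θ)(t)` continuous for `t < T`. Why it might fail: no
mathematical obstruction (Fubini for the finite empirical sum and integrability of continuous fields
on `𝕋³`). Sources: Spohn1991 Part I §3.1, OllaVaradhanYau1993 §1. -/
theorem stub_blocksToFields :
    ∀ σ : ℝ, 0 < σ → ∀ (a₀ θ₀ : T3 → ℝ) (u₀ : T3 → V3) (T : ℝ) (ρ θ : ℝ → T3 → ℝ) (u : ℝ → T3 → V3),
      IsHardSphereEulerSolution σ T ρ u θ → ∀ Φ : Flows σ, ∀ t ∈ Set.Ico 0 T,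
        (∀ δ : ℝ, 0 < δ →
          Tendsto (fun N : ℕ => localGibbsLaw σ a₀ u₀ θ₀ N (Φ N)
            {z | δ < blockDev ρ θ u (Φ N) t z}) atTop (𝓝 0)) →
        TendstoHydroFieldsAt (fun N => localGibbsLaw σ a₀ u₀ θ₀ N (Φ N)) Φ ρ u θ t := by
  sorry

/-! ## The stub STATEMENTS under the stubs' own registered names (hypotheses of `WeakStrongToInBand_of`)

The layer-invariant audit admits, as hypotheses of the theorem concluding the crux, only registered
obligations BY NAME; `Statement.stub_x := type_of% stub_x` is the statement of the registered stub
`stub_x` under the same short name (D-0027 §3.3 shape). -/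

namespace Statement

/-- Statement of S1 `stub_blockLLNAtZero`. -/
abbrev stub_blockLLNAtZero : Prop := type_of% Birth.stub_blockLLNAtZero
/-- Statement of S2 `stub_blockCapPreShock`. -/
abbrev stub_blockCapPreShock : Prop := type_of% Birth.stub_blockCapPreShock
/-- Statement of S3 `stub_goodEventLikely`. -/
abbrev stub_goodEventLikely : Prop := type_of% Birth.stub_goodEventLikely
/-- Statement of S4 `stub_pathwiseDafermos`. -/
abbrev stub_pathwiseDafermos : Prop := type_of% Birth.stub_pathwiseDafermos
/-- Statement of S5 `stub_blocksToFields`. -/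
abbrev stub_blocksToFields : Prop := type_of% Birth.stub_blocksToFields

end Statement

/-! ## Composition (sorry-free): the five stubs ⟹ the crux BY NAME -/

/-- **The skeleton theorem.** `η₀ := min η̄₃ η̄₄ / 2` (S3's and S4's thresholds), `σ₀ := min σ₁ (min σ₂
σ₃)`. Given the band `ρσ³ < η₀` of the Statement, the `t = 0` LLN and `t < T`: S5 reduces the
conclusion to block convergence at `t`; for `ε > 0`, S4 supplies `(F, δ, N₀)`; for `N ≥ N₀` the event
`{ε < blockDev(t)}` lies in `GoodEventᶜ ∪ {block cap fails} ∪ {δ < blockDev(0)}` (contrapositive of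
S4), and the three probabilities tend to `0` by S3 (fed with the crux's antecedents; the inlined
`TransferInequality` matches by `δ`-unfolding), S2 and S1. `GibbsInvariance` is not used here. -/
theorem WeakStrongToInBand_of (h1 : Statement.stub_blockLLNAtZero)
    (h2 : Statement.stub_blockCapPreShock) (h3 : Statement.stub_goodEventLikely)
    (h4 : Statement.stub_pathwiseDafermos) (h5 : Statement.stub_blocksToFields) :
    Summit.AtomisticToContinuum.HydrodynamicLimit.Theses.SuperextensiveClosureCost.WeakStrongToInBand := by
  intro hM hE hV hD hT _hG hB
  obtain ⟨ηa, hηa, H3⟩ := (h3 : type_of% Birth.stub_goodEventLikely) hM hE hV hD hT hB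
  obtain ⟨ηb, hηb, H4⟩ := (h4 : type_of% Birth.stub_pathwiseDafermos)
  have hη : 0 < min ηa ηb := lt_min hηa hηb
  refine ⟨min ηa ηb / 2, half_pos hη, ?_⟩
  intro a₀ θ₀ u₀ ha hθ hu ha0 hθ0
  obtain ⟨σ₁, hσ₁, H1⟩ := (h1 : type_of% Birth.stub_blockLLNAtZero) a₀ θ₀ u₀ ha hθ hu ha0 hθ0
  obtain ⟨K, σ₂, hσ₂, H2⟩ := (h2 : type_of% Birth.stub_blockCapPreShock) a₀ θ₀ u₀ ha hθ hu ha0 hθ0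
  obtain ⟨σ₃, hσ₃, H3'⟩ := H3 (min ηa ηb) hη (min_le_left _ _) a₀ θ₀ u₀ ha hθ hu ha0 hθ0
  refine ⟨min σ₁ (min σ₂ σ₃), lt_min hσ₁ (lt_min hσ₂ hσ₃), ?_⟩
  intro σ hσ hσlt T ρ θ u hsol hband Φ h0 t ht
  have hσ1 : σ < σ₁ := lt_of_lt_of_le hσlt (min_le_left _ _)
  have hσ2 : σ < σ₂ := lt_of_lt_of_le hσlt ((min_le_right _ _).trans (min_le_left _ _))
  have hσ3 : σ < σ₃ := lt_of_lt_of_le hσlt ((min_le_right _ _).trans (min_le_right _ _))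
  have hT0 : 0 < T := lt_of_le_of_lt ht.1 ht.2
  refine (h5 : type_of% Birth.stub_blocksToFields) σ hσ a₀ θ₀ u₀ T ρ θ u hsol Φ t ht ?_
  intro ε hε
  obtain ⟨F, δ, hδ, N₀, Himp⟩ :=
    H4 (min ηa ηb) hη (min_le_right _ _) K σ hσ T ρ θ u hsol hband t ht ε hε
  have hA := H3' σ hσ hσ3 T ρ θ u hsol hband Φ h0 t ht F δ hδ
  have hB := H2 σ hσ hσ2 T ρ θ u hsol Φ h0 t ht
  have hC := H1 σ hσ hσ1 T ρ θ u hsol hT0 Φ h0 δ hδ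
  have hsum : Tendsto (fun N : ℕ =>
      localGibbsLaw σ a₀ u₀ θ₀ N (Φ N) (GoodEvent σ (min ηa ηb) t F δ (Φ N))ᶜ +
        localGibbsLaw σ a₀ u₀ θ₀ N (Φ N) {z | ¬ BlockCapsHold K t (Φ N) z} +
        localGibbsLaw σ a₀ u₀ θ₀ N (Φ N) {z | δ < blockDev ρ θ u (Φ N) 0 z}) atTop (𝓝 0) := by
    simpa using (hA.add hB).add hC
  refine tendsto_of_tendsto_of_tendsto_of_le_of_le' tendsto_const_nhds hsum
    (Eventually.of_forall fun _ => zero_le) ?_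
  filter_upwards [eventually_ge_atTop N₀] with N hN
  refine (measure_mono ?_).trans
    ((measure_union_le _ _).trans (add_le_add (measure_union_le _ _) le_rfl))
  intro z hz
  by_contra hcon
  simp only [Set.mem_union, Set.mem_compl_iff, Set.mem_setOf_eq, not_or, not_not, not_lt] at hcon
  obtain ⟨⟨hgood, hcap⟩, hinit⟩ := hcon
  exact absurd (Himp N hN (Φ N) z hgood hcap hinit) (not_le.mpr hz)

end Summit.AtomisticToContinuum.HydrodynamicLimit.Cruxes.WeakStrongToInBand.Birth

end
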